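import Summits.Parity.GeneralizedHardyLittlewood.Theorems.GreenTaoLevelTwoGITwoCyclicInverseBSGPaths

/-!
# Route `GreenTaoLevelTwo`, crux `GITwo` (stmt-Parity-21275), line `birth`, stub `stub_cyclicInverse`:
# towards Balog–Szemerédi–Gowers — paths of length three, preliminaries

Sixth helper file toward the XL stub `stub_cyclicInverse` (B. Green, T. Tao, arXiv:math/0503014,
Thm. 68 = PEMS 51 (2008) Thm. 12.8), continuing the Balog–Szemerédi–Gowers brick (arXiv Thm. 25):
after `…BSGPaths` (dependent random choice) and `…BSGPopular` (popular sums), this def-free file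
proves the **paths of length three lemma** for a bipartite edge finset `E ⊆ A × B` with
`#E ≥ #A·#B/K` (`K ≥ 1`): there are `A' ⊆ A`, `B' ⊆ B` with `#A' ≥ #A/(12K²)`, `#B' ≥ #B/(4K)` such
that every pair `(a, b) ∈ A' × B'` is joined by at least `#A·#B/(2¹⁵K⁶)` paths `a — b₁ — a₁ — b`.

Steps (Gowers 1998 §7; Sudakov–Szemerédi–Vu 2005; Tao–Vu §6.4), each a separate lemma:
* `card_edges_highDeg_ge` — restricting to left vertices of degree `≥ #B/(2K)` keeps `≥ #A#B/(2K)` edges;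
* `exists_vertex_many_rich_pairs_nbhd` — dependent random choice in vertex form (from `…BSGPaths`);
* `two_mul_card_prune_ge` — deleting the vertices with `> 2ε#S` poor partners keeps half of `S`;
* `card_richRight_ge` — the right vertices with `≥ #S/(4K)` neighbours in `S` number `≥ #B/(4K)`;
* `card_paths_ge_sum_codeg` — paths `a — b₁ — a₁ — b` counted through rich middle vertices `a₁`;
(the assembled lemma `exists_paths_of_length_three` is in the sibling file `…BSGPathsThree`).

References: [GreenTao2008U3Inverse] arXiv:math/0503014 Thm. 25; W. T. Gowers, GAFA 8 (1998) §7;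
B. Sudakov, E. Szemerédi, V. Vu, Duke Math. J. 129 (2005) Lemma 3.?; T. Tao, V. Vu, *Additive
Combinatorics*, §6.4.
-/

namespace Summit.Parity.GeneralizedHardyLittlewood.GreenTaoLevelTwoGITwoCyclicInverse

open Finset

variable {α β : Type*} [DecidableEq α] [DecidableEq β]

/-! ### Step A: high-degree left vertices -/

omit [DecidableEq β] in
/-- Degree sum over the left class: `∑_{a ∈ A} #{e ∈ E : e.1 = a} = #E`. [folklore] -/
theorem sum_card_edgeFiber_fst_eq_card (A : Finset α) (E : Finset (α × β)) (hE : ∀ e ∈ E, e.1 ∈ A) :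
    ∑ a ∈ A, #{e ∈ E | e.1 = a} = #E :=
  (Finset.card_eq_sum_card_fiberwise hE).symm

omit [DecidableEq β] in
/-- **High-degree restriction.** If `#E ≥ #A#B/K` then the edges whose left vertex has degree
`≥ #B/(2K)` number at least `#A#B/(2K)`. [folklore] -/
theorem card_edges_highDeg_ge (A : Finset α) (B : Finset β) (E : Finset (α × β))
    (hEA : ∀ e ∈ E, e.1 ∈ A) {K : ℝ} (hK : 0 < K) (hcard : (#A : ℝ) * #B / K ≤ #E) :
    (#A : ℝ) * #B / (2 * K) ≤
      #{e ∈ E | (#B : ℝ) / (2 * K) ≤ #{e' ∈ E | e'.1 = e.1}} := by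
  -- split the degree sum according to the degree of the left vertex
  have hsum := sum_card_edgeFiber_fst_eq_card A E hEA
  set Ahi := {a ∈ A | (#B : ℝ) / (2 * K) ≤ #{e' ∈ E | e'.1 = a}} with hAhi
  have hhi : #{e ∈ E | (#B : ℝ) / (2 * K) ≤ #{e' ∈ E | e'.1 = e.1}} = ∑ a ∈ Ahi, #{e ∈ E | e.1 = a} := by
    rw [card_eq_sum_card_fiberwise (f := fun e : α × β => e.1)
      (s := {e ∈ E | (#B : ℝ) / (2 * K) ≤ #{e' ∈ E | e'.1 = e.1}}) (t := Ahi)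
      (fun e he => by
        have he' : e ∈ {e ∈ E | (#B : ℝ) / (2 * K) ≤ #{e' ∈ E | e'.1 = e.1}} := he
        rw [mem_filter] at he'
        show e.1 ∈ Ahi
        rw [hAhi, mem_filter]
        exact ⟨hEA e he'.1, he'.2⟩)]
    refine sum_congr rfl fun a ha => ?_
    congr 1
    ext e
    simp only [mem_filter]
    constructor
    · rintro ⟨⟨he, -⟩, hea⟩; exact ⟨he, hea⟩
    · rintro ⟨he, hea⟩
      refine ⟨⟨he, ?_⟩, hea⟩
      rw [hea]; rw [hAhi, mem_filter] at ha; exact ha.2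
  have hlo : (∑ a ∈ A \ Ahi, (#{e ∈ E | e.1 = a} : ℝ)) ≤ #A * (#B / (2 * K)) := by
    calc (∑ a ∈ A \ Ahi, (#{e ∈ E | e.1 = a} : ℝ)) ≤ ∑ _a ∈ A \ Ahi, (#B : ℝ) / (2 * K) := by
          refine sum_le_sum fun a ha => ?_
          rw [mem_sdiff, hAhi, mem_filter] at ha
          have := ha.2
          push Not at this
          exact (this ha.1).le
      _ = #(A \ Ahi) * ((#B : ℝ) / (2 * K)) := by rw [sum_const, nsmul_eq_mul]
      _ ≤ #A * ((#B : ℝ) / (2 * K)) := by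
          gcongr
          exact sdiff_le
  have hsplit : (∑ a ∈ A, (#{e ∈ E | e.1 = a} : ℝ)) =
      (∑ a ∈ Ahi, (#{e ∈ E | e.1 = a} : ℝ)) + ∑ a ∈ A \ Ahi, (#{e ∈ E | e.1 = a} : ℝ) := by
    rw [← sum_sdiff (filter_subset _ A : Ahi ⊆ A), add_comm]
  have hE : (#E : ℝ) = ∑ a ∈ A, (#{e ∈ E | e.1 = a} : ℝ) := by exact_mod_cast hsum.symm
  rw [hhi]
  push_cast
  have : (#A : ℝ) * #B / K = #A * (#B / (2 * K)) + #A * #B / (2 * K) := by ring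
  linarith

/-! ### Step B: dependent random choice in vertex form -/

/-- Dependent random choice (`exists_vertex_many_rich_pairs`) restated with the neighbourhood
`A₁ = {a ∈ A : (a, b) ∈ E}` in place of the edge fibre over `b`. [folklore] -/
theorem exists_vertex_many_rich_pairs_nbhd (A : Finset α) (B : Finset β) (E : Finset (α × β))
    (hEA : ∀ e ∈ E, e.1 ∈ A) (hEB : ∀ e ∈ E, e.2 ∈ B) (hB : B.Nonempty) {K ε : ℝ} (hK : 0 < K)
    (hε : 0 < ε) (hcard : (#A : ℝ) * #B / K ≤ #E) :
    ∃ b ∈ B, (#A : ℝ) ^ 2 / (2 * K ^ 2) ≤ (#{a ∈ A | (a, b) ∈ E} : ℝ) ^ 2 ∧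
      (#{p ∈ {a ∈ A | (a, b) ∈ E} ×ˢ {a ∈ A | (a, b) ∈ E} |
          (#{b' ∈ B | (p.1, b') ∈ E ∧ (p.2, b') ∈ E} : ℝ) < ε / (2 * K ^ 2) * #B} : ℝ) ≤
        ε * (#{a ∈ A | (a, b) ∈ E} : ℝ) ^ 2 := by
  obtain ⟨b, hbB, h1, h2⟩ := exists_vertex_many_rich_pairs A B E hEA hEB hB hK hε hcard
  have hfib := card_edgeFiber_eq_card_nbhd A E hEA b
  refine ⟨b, hbB, ?_, ?_⟩
  · rw [← hfib]; exact h1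
  · rw [← hfib]
    refine le_trans (le_of_eq ?_) h2
    congr 1
    refine Finset.card_nbij' (fun p => ((p.1, b), (p.2, b))) (fun q => (q.1.1, q.2.1)) ?_ ?_ ?_ ?_
    · intro p hp
      simp only [mem_coe, mem_filter, mem_product] at hp ⊢
      exact ⟨⟨⟨hp.1.1.2, trivial⟩, hp.1.2.2, trivial⟩, hp.2⟩
    · intro q hq
      simp only [mem_coe, mem_filter, mem_product] at hq ⊢
      obtain ⟨⟨⟨hq1, hq1b⟩, hq2, hq2b⟩, hpoor⟩ := hq
      refine ⟨⟨⟨hEA _ hq1, ?_⟩, hEA _ hq2, ?_⟩, hpoor⟩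
      · have : q.1 = (q.1.1, b) := by rw [← hq1b]
        rw [← this]; exact hq1
      · have : q.2 = (q.2.1, b) := by rw [← hq2b]
        rw [← this]; exact hq2
    · intro p _; rfl
    · intro q hq
      simp only [mem_coe, mem_filter, mem_product] at hq
      obtain ⟨⟨⟨-, hq1b⟩, -, hq2b⟩, -⟩ := hq
      exact Prod.ext (Prod.ext rfl hq1b.symm) (Prod.ext rfl hq2b.symm)

/-! ### Step C: pruning vertices with many poor partners -/

omit [DecidableEq β] in
/-- **Pruning.** If a set `R` of ordered pairs from `S` has `#R ≤ ε(#S)²`, then at least half of the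
elements of `S` have at most `2ε#S` partners in `R`. [folklore] -/
theorem two_mul_card_prune_ge (S : Finset α) (R : Finset (α × α)) (hR : R ⊆ S ×ˢ S) {ε : ℝ}
    (hcard : (#R : ℝ) ≤ ε * (#S : ℝ) ^ 2) :
    (#S : ℝ) ≤ 2 * #{a ∈ S | (#{p ∈ R | p.1 = a} : ℝ) ≤ 2 * ε * #S} := by
  rcases S.eq_empty_or_nonempty with hS | hS
  · simp [hS]
  have hSpos : (0 : ℝ) < #S := by exact_mod_cast hS.card_pos
  have hsum : ∑ a ∈ S, #{p ∈ R | p.1 = a} = #R :=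
    (card_eq_sum_card_fiberwise fun p hp => (mem_product.mp (hR hp)).1).symm
  set T := {a ∈ S | (#{p ∈ R | p.1 = a} : ℝ) ≤ 2 * ε * #S} with hT
  -- the complement contributes more than `2ε#S` per element
  have h1 : (#(S \ T) : ℝ) * (2 * ε * #S) ≤ ∑ a ∈ S \ T, (#{p ∈ R | p.1 = a} : ℝ) := by
    rw [← nsmul_eq_mul, ← sum_const]
    refine sum_le_sum fun a ha => ?_
    rw [mem_sdiff, hT, mem_filter] at ha
    have := ha.2; push Not at this
    exact (this ha.1).le
  have h2 : ∑ a ∈ S \ T, (#{p ∈ R | p.1 = a} : ℝ) ≤ ∑ a ∈ S, (#{p ∈ R | p.1 = a} : ℝ) :=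
    sum_le_sum_of_subset_of_nonneg sdiff_subset fun _ _ _ => Nat.cast_nonneg _
  have h3 : ∑ a ∈ S, (#{p ∈ R | p.1 = a} : ℝ) = #R := by exact_mod_cast hsum
  have h4 : (#(S \ T) : ℝ) = #S - #T := by
    rw [card_sdiff_of_subset (filter_subset _ S : T ⊆ S)]
    push_cast [Nat.cast_sub (card_le_card (filter_subset _ S : T ⊆ S))]
    ring
  have h5 : (#(S \ T) : ℝ) * (2 * ε * #S) ≤ ε * (#S : ℝ) ^ 2 := by linarith
  rw [h4] at h5
  -- `(#S - #T) 2ε #S ≤ ε #S²` ⇒ `#S ≤ 2 #T` (divide by `ε #S > 0` when `ε > 0`; trivial otherwise)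
  rcases le_or_gt ε 0 with hε | hε
  swap
  · have key : ε * #S * ((#S : ℝ) - 2 * #T) ≤ 0 := by nlinarith [h5]
    by_contra hcon
    push Not at hcon
    have : 0 < ε * #S * ((#S : ℝ) - 2 * #T) := mul_pos (mul_pos hε hSpos) (by linarith)
    linarith
  · -- then `#R ≤ 0`, so `R = ∅` and `T = S`
    have hR0 : (#R : ℝ) ≤ 0 := hcard.trans (mul_nonpos_of_nonpos_of_nonneg hε (sq_nonneg _))
    have hR0' : #R = 0 := by exact_mod_cast le_antisymm (by exact_mod_cast hR0) (Nat.zero_le _)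
    have hTS : T = S := by
      rw [hT]
      refine filter_true_of_mem fun a ha => ?_
      have : #{p ∈ R | p.1 = a} = 0 := by
        rw [card_eq_zero.mp hR0']; simp
      rw [this]; push_cast
      nlinarith [hSpos.le]
    rw [hTS]; linarith

/-! ### Step D: right vertices with many neighbours in `S` -/

/-- **Rich right vertices.** If every `a ∈ S ⊆ A` has degree `≥ #B/(2K)` into `B`, then at least
`#B/(4K)` vertices `b ∈ B` have at least `#S/(4K)` neighbours in `S`. [folklore] -/
theorem card_richRight_ge (S : Finset α) (B : Finset β) (E : Finset (α × β))
    (hEB : ∀ e ∈ E, e.2 ∈ B) (hS : S.Nonempty) {K : ℝ} (hK : 0 < K)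
    (hdeg : ∀ a ∈ S, (#B : ℝ) / (2 * K) ≤ #{e ∈ E | e.1 = a}) :
    (#B : ℝ) / (4 * K) ≤ #{b ∈ B | (#S : ℝ) / (4 * K) ≤ #{a ∈ S | (a, b) ∈ E}} := by
  have hSpos : (0 : ℝ) < #S := by exact_mod_cast hS.card_pos
  -- the edges from `S`, counted from the left and from the right
  set ES := {e ∈ E | e.1 ∈ S} with hES
  have hleft : (#S : ℝ) * (#B / (2 * K)) ≤ #ES := by
    have h := card_eq_sum_card_fiberwise (f := fun e : α × β => e.1) (s := ES) (t := S)
      (fun e he => by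
        have he' : e ∈ ES := he
        rw [hES, mem_filter] at he'; exact he'.2)
    have h' : ∀ a ∈ S, #{e ∈ ES | e.1 = a} = #{e ∈ E | e.1 = a} := by
      intro a ha
      congr 1; ext e; simp only [hES, mem_filter]
      constructor
      · rintro ⟨⟨he, -⟩, hea⟩; exact ⟨he, hea⟩
      · rintro ⟨he, hea⟩; exact ⟨⟨he, by rw [hea]; exact ha⟩, hea⟩
    rw [h, ← nsmul_eq_mul, ← sum_const]
    push_cast
    exact sum_le_sum fun a ha => by rw [h' a ha]; exact hdeg a ha
  have hright : (#ES : ℝ) = ∑ b ∈ B, (#{a ∈ S | (a, b) ∈ E} : ℝ) := by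
    have h := card_eq_sum_card_fiberwise (f := fun e : α × β => e.2) (s := ES) (t := B)
      (fun e he => by
        have he' : e ∈ ES := he
        rw [hES, mem_filter] at he'; exact hEB e he'.1)
    rw [h]; push_cast
    refine sum_congr rfl fun b _ => ?_
    congr 1
    refine Finset.card_nbij' (fun e => e.1) (fun a => (a, b)) ?_ ?_ ?_ ?_
    · intro e he
      simp only [mem_coe, mem_filter, hES] at he ⊢
      obtain ⟨⟨he, heS⟩, heb⟩ := he
      refine ⟨heS, ?_⟩
      have : e = (e.1, b) := by rw [← heb]
      rw [← this]; exact he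
    · intro a ha
      simp only [mem_coe, mem_filter, hES] at ha ⊢
      exact ⟨⟨ha.2, ha.1⟩, trivial⟩
    · intro e he
      simp only [mem_coe, mem_filter] at he
      exact Prod.ext rfl he.2.symm
    · intro a _; rfl
  set Bhi := {b ∈ B | (#S : ℝ) / (4 * K) ≤ #{a ∈ S | (a, b) ∈ E}} with hBhi
  have hlo : ∑ b ∈ B \ Bhi, (#{a ∈ S | (a, b) ∈ E} : ℝ) ≤ #B * (#S / (4 * K)) := by
    calc ∑ b ∈ B \ Bhi, (#{a ∈ S | (a, b) ∈ E} : ℝ) ≤ ∑ _b ∈ B \ Bhi, (#S : ℝ) / (4 * K) := by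
          refine sum_le_sum fun b hb => ?_
          rw [mem_sdiff, hBhi, mem_filter] at hb
          have := hb.2; push Not at this
          exact (this hb.1).le
      _ = #(B \ Bhi) * ((#S : ℝ) / (4 * K)) := by rw [sum_const, nsmul_eq_mul]
      _ ≤ #B * ((#S : ℝ) / (4 * K)) := by
          gcongr; exact sdiff_le
  have hhi : ∑ b ∈ Bhi, (#{a ∈ S | (a, b) ∈ E} : ℝ) ≤ #Bhi * #S := by
    rw [← nsmul_eq_mul, ← sum_const]
    refine sum_le_sum fun b _ => ?_
    exact_mod_cast card_le_card (filter_subset _ S)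
  have hsplit : ∑ b ∈ B, (#{a ∈ S | (a, b) ∈ E} : ℝ) =
      ∑ b ∈ Bhi, (#{a ∈ S | (a, b) ∈ E} : ℝ) + ∑ b ∈ B \ Bhi, (#{a ∈ S | (a, b) ∈ E} : ℝ) := by
    rw [← sum_sdiff (filter_subset _ B : Bhi ⊆ B), add_comm]
  -- combine: `#S #B/(2K) ≤ #ES ≤ #Bhi #S + #B #S/(4K)`
  have e1 : (#S : ℝ) * (#B / (2 * K)) = 2 * (#S * #B / (4 * K)) := by ring
  have e2 : (#B : ℝ) * (#S / (4 * K)) = #S * #B / (4 * K) := by ring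
  have e3 : (#B : ℝ) / (4 * K) * #S = #S * #B / (4 * K) := by ring
  rw [e1] at hleft
  rw [e2] at hlo
  have h1 : 2 * ((#S : ℝ) * #B / (4 * K)) ≤ #Bhi * #S + #S * #B / (4 * K) := by linarith
  have h3 : (#B : ℝ) / (4 * K) * #S ≤ #Bhi * #S := by rw [e3]; linarith
  exact le_of_mul_le_mul_right h3 hSpos

/-! ### Step E: counting paths through rich middle vertices -/

/-- **Paths through rich middle vertices.** For fixed `a, b` and a set `N` of middle vertices `a₁`
adjacent to `b`, the paths `a — b₁ — a₁ — b` (`b₁ ∈ B`, `a₁ ∈ N`) number at least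
`∑_{a₁ ∈ N} codeg(a, a₁)`. [folklore] -/
theorem sum_codeg_le_card_paths (A : Finset α) (B : Finset β) (E : Finset (α × β)) (a : α) (b : β)
    (N : Finset α) (hN : N ⊆ A) (hNb : ∀ a₁ ∈ N, (a₁, b) ∈ E) :
    ∑ a₁ ∈ N, #{b₁ ∈ B | (a, b₁) ∈ E ∧ (a₁, b₁) ∈ E} ≤
      #{q ∈ B ×ˢ A | (a, q.1) ∈ E ∧ (q.2, q.1) ∈ E ∧ (q.2, b) ∈ E} := by
  rw [card_eq_sum_card_fiberwise (f := fun q : β × α => q.2)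
    (s := {q ∈ B ×ˢ A | (a, q.1) ∈ E ∧ (q.2, q.1) ∈ E ∧ (q.2, b) ∈ E}) (t := A)
    (fun q hq => by
      have hq' : q ∈ {q ∈ B ×ˢ A | (a, q.1) ∈ E ∧ (q.2, q.1) ∈ E ∧ (q.2, b) ∈ E} := hq
      exact (mem_product.mp (mem_filter.mp hq').1).2)]
  calc ∑ a₁ ∈ N, #{b₁ ∈ B | (a, b₁) ∈ E ∧ (a₁, b₁) ∈ E}
      ≤ ∑ a₁ ∈ N, #{q ∈ {q ∈ B ×ˢ A | (a, q.1) ∈ E ∧ (q.2, q.1) ∈ E ∧ (q.2, b) ∈ E} | q.2 = a₁} := by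
        refine sum_le_sum fun a₁ ha₁ => ?_
        refine Finset.card_le_card_of_injOn (fun b₁ => (b₁, a₁)) ?_ ?_
        · intro b₁ hb₁
          simp only [mem_coe, mem_filter, mem_product] at hb₁ ⊢
          exact ⟨⟨⟨hb₁.1, hN ha₁⟩, hb₁.2.1, hb₁.2.2, hNb a₁ ha₁⟩, trivial⟩
        · intro b₁ _ b₁' _ h
          exact congrArg Prod.fst h
    _ ≤ ∑ a₁ ∈ A, #{q ∈ {q ∈ B ×ˢ A | (a, q.1) ∈ E ∧ (q.2, q.1) ∈ E ∧ (q.2, b) ∈ E} | q.2 = a₁} :=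
        sum_le_sum_of_subset_of_nonneg hN fun _ _ _ => Nat.zero_le _

end Summit.Parity.GeneralizedHardyLittlewood.GreenTaoLevelTwoGITwoCyclicInverse
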